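import Literature.NumberTheory.Automorphic.ArchSplitPlaceStandardise        -- ★ (e3-5) `formRe_lineOf_signs`, `unitaryGroupOfForm_smul_eq`, `sqrt_ratio_ne_zero`; brings ★ atlas, ★ `ArchLocalRelabelTransport`, ★ `UnitaryGroupFormTransport`, ★ `conj_monomialGL_boostStd_eq_gprimeSplitGL`
import Literature.NumberTheory.Automorphic.ArchInnerFormChartLocal           -- ★ G1 `gprimeBlockAt`, `gprimeBlockAtHom`, `chartTorusGLoc`
import Literature.NumberTheory.Automorphic.UnitaryGroupRestrictedProduct     -- ★ `ContinuousMulEquiv.restrictSubgroup`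
import HarnessLib

/-!
# The explicit place isomorphism `U(α)_w ≃ₜ* U(β)_w` between two inner forms at a common indefinite place, carrying the Cartan atlas chart to chart
# (N8-INNER brick (IT) «IDENTITY TRANSPORT AT I-PLACES», algebraic half; Platonov–Rapinchuk 1994 §2.3; Rogawski 1990 §3.6, §14.2; Knapp 1986 V §3)

Topic `NumberTheory/Automorphic`; namespace `Literature.NumberTheory.Automorphic.UnitaryGroup`.  THEOREMS ONLY (no `def`, no instance, no notation, no axiom, no named fact,
no `sorry`).  Cell `pub/hodgecm-mathlib`, crux H413 (`stmt-HodgeConjecture-24833`), half-A line LH2, road «N8-INNER» (LEAD T14-4 (L2)); brick (IT) of the road owner LH2-plan (g1)'s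
ROAD FORK (2026-09-02T16:08:52Z, EULER–POINCARÉ road), seat LH7-p04 (g8).  Count-neutral bookkeeping; pays no organ by itself.

THE MATHEMATICS.  Two diagonal house frames `α`, `β` (`α_i, β_i ≠ 0`, `σ_w α_i`, `σ_w β_i` real) and a complex place `w` that is a SPLIT-CHART place for both (an `α`-indefinite place `w ∈ I`,
every place being split-chart for the quasi-split `β₀ = (½, 1, −½)`): then `U(α)_w = U(σ_w diag α)(ℂ)` and `U(β)_w` are both `U(2,1)`, and the two place charts of the ★ Cartan atlas
(`gprimeBlockAt δ w S′ c`: the boost `gprimeSplitGL τ_δ (formRe δ w) c` at `w ∈ S′`, the unit diagonal `gprimeCptGL τ_δ c` at `w ∉ S′`, `τ_δ = lineOf (formSign δ w)` the sign-adapted slot order)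
differ by an EXPLICIT real congruence.  In slot order write `a′ = formRe α w ∘ τ_α`, `b′ = formRe β w ∘ τ_β` (both with `δ′₀δ′₂ < 0 < δ′₀δ′₁`, ★ `formRe_lineOf_signs`), `r_δ = √(−δ′₂∕δ′₀)`
(★ `cayB`'s token) and **`D = diag(1, d₁, r_a∕r_b)`**, `d₁ = √(b′₀a′₁∕(a′₀b′₁))`.  Then (§1) **`D · boostStd(a′, c) = boostStd(b′, c) · D` for EVERY `c`** (the boost reads the form only through
`r`, and `(d₀∕d₂)·r_a = r_b`) and **`D · diag(b′) · D = (b′₀∕a′₀) • diag(a′)`** (so `U(diag a′) = U(Dᴴ diag(b′) D)`, ★ `unitaryGroupOfForm_smul_eq`).  With the permutation matrices `M(τ)`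
(★ `ArchLocalRelabelTransport`: `M(τ)ᴴ · σ_w diag δ · M(τ) = σ_w diag(δ ∘ τ)`) put **`M_w := M(τ_β) · D · M(τ_α)⁻¹ ∈ GL₃(ℂ)`**; then `M_wᴴ · σ_w diag β · M_w = (b′₀∕a′₀) • σ_w diag α`, so
`g ↦ M_w g M_w⁻¹` is a topological-group isomorphism **`ι_w : U(α)_w ≃ₜ* U(β)_w`** (★ `ContinuousMulEquiv.restrictSubgroup (GLn.conjEquiv M_w)`, membership by ★ `conj_mem_unitaryGroupOfForm_iff`),
and it carries EVERY chart point to the chart point with the SAME label and coordinates (§3): at `w ∈ S′` by the boost identity and ★ `conj_monomialGL_boostStd_eq_gprimeSplitGL`, at `w ∉ S′`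
because `D` commutes with diagonals and `M(τ)` relabels them (★ `monomial_conj_circleDiagonal`).  Consequently `ι_w` carries the local chart torus `T′_{S′,w}` (closure of the chart range)
onto `T′_{S′,w}` (§4, the `hHH′` binder of ★ `cosetCongr`) — the input of the measure half (`chartOrbGLoc ↦ chartOrbGLoc`, sibling file).  [Rogawski1990, §14.2 p. 233: «if `v ∉ S₀` we use
`ψ_v` to identify `G′_v` with `G_v` … take `f_v` equal to `f′_v`; then (14.2.1) is obviously satisfied» — this is that identification, place by place, on the tree's Cartan atlas.]
* §1 `diagonal_mul_boostStd_eq_boostStd_mul_diagonal`, `formCongr_diagonal_real_diagonal`; §2 `formCongr_mul`, `formCongr_smul`, the sign∕ratio bookkeeping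
  `innerTwistScale_*`; §3 **`exists_continuousMulEquiv_archLocal_innerTwist`** (IT1: `∃ ι`, chart clause for ALL labels + ambient-conjugation clause `∃ M`);
  §4 **`innerTwist_mem_chartTorusGLoc_iff`** (IT2, binder form: any `ι` with the chart clause), `innerTwist_image_chartTorusGLoc`.
HONEST LABEL: HC_CM is proved only modulo the 7 printed citations (2 remaining: hLiu418 = `stmt-HodgeConjecture-24832`, h413 = `stmt-HodgeConjecture-24833`) until rung 0
closes; chart bookkeeping for the in-house road of row 2 `stub_N8`, count-neutral (+0∕+0).

## References
* [PlatonovRapinchuk1994] V. Platonov, A. Rapinchuk, *Algebraic Groups and Number Theory* (1994), §2.3 (equivalent hermitian forms have conjugate unitary groups).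
* [Rogawski1990] J. D. Rogawski, *Automorphic Representations of Unitary Groups in Three Variables*, Ann. of Math. Stud. 123 (1990), §3.6 p. 31 (Cartan subgroups of `U(2,1)`),
  §14.2 pp. 232–233 (`ψ_v : G′_v ≅ G_v` off `S₀`).
* [Knapp1986] A. W. Knapp, *Representation Theory of Semisimple Groups* (1986), Ch. V §3 (the boost of `SU(2,1)`).
* [BrockerTomDieck1985] T. Bröcker, T. tom Dieck, *Representations of Compact Lie Groups* (1985), IV (3.2) (permutation matrices relabel the torus).
-/

set_option autoImplicit false

noncomputable section

open NumberField NumberField.InfinitePlace Matrix Complex Equiv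
open Literature.LinearAlgebra.Matrix
open scoped MatrixGroups Matrix ComplexConjugate Real

namespace Literature.NumberTheory.Automorphic.UnitaryGroup

/-! ## §1 Standard position: the diagonal rescaling between two hyperbolic frames -/

section Standard

variable (a b : Fin 3 → ℝ)

/-- **THE BOOST READS THE FORM ONLY THROUGH `r = √(−b₂∕b₀)`**: for a real diagonal `d` with `d₀ · r_a = r_b · d₂` and `d₂ · r_a⁻¹ = r_b⁻¹ · d₀`,
`diag(d) · boostStd(a, c) = boostStd(b, c) · diag(d)` for every `c` (entrywise). [cite: Knapp1986, Ch. V §3] -/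
theorem diagonal_mul_boostStd_eq_boostStd_mul_diagonal (d : Fin 3 → ℝ) (h02 : d 0 * Real.sqrt (-a 2 / a 0) = Real.sqrt (-b 2 / b 0) * d 2)
    (h20 : d 2 * (Real.sqrt (-a 2 / a 0))⁻¹ = (Real.sqrt (-b 2 / b 0))⁻¹ * d 0) (c : Fin 3 → ℝ) :
    Matrix.diagonal (fun i => (d i : ℂ)) * boostStd a c = boostStd b c * Matrix.diagonal (fun i => (d i : ℂ)) := by
  have h02' : (d 0 : ℂ) * (Real.sqrt (-a 2 / a 0) : ℂ) = (Real.sqrt (-b 2 / b 0) : ℂ) * (d 2 : ℂ) := by exact_mod_cast h02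
  have h20' : (d 2 : ℂ) * ((Real.sqrt (-a 2 / a 0) : ℂ))⁻¹ = ((Real.sqrt (-b 2 / b 0) : ℂ))⁻¹ * (d 0 : ℂ) := by
    have h := h20
    rw [← Complex.ofReal_inj] at h
    push_cast at h
    exact h
  ext i j
  fin_cases i <;> fin_cases j <;> simp [boostStd, Matrix.diagonal_mul, Matrix.mul_diagonal, -Complex.ofReal_sinh, -Complex.ofReal_cosh]
  all_goals first
    | ring1
    | (linear_combination (Complex.exp ((c 2 : ℂ) * I) * (Real.sinh (c 0) : ℂ)) * h02')
    | (linear_combination (-(Complex.exp ((c 2 : ℂ) * I) * (Real.sinh (c 0) : ℂ))) * h02')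
    | (linear_combination (Complex.exp ((c 2 : ℂ) * I) * (Real.sinh (c 0) : ℂ)) * h20')

/-- `Dᴴ · diag(b) · D = diag(d_i² b_i)` for a real diagonal `D = diag(d)` (`formCongr` currency of ★ `UnitaryGroupFormTransport`). [cite: PlatonovRapinchuk1994, §2.3] -/
theorem formCongr_diagonal_real_diagonal (d : Fin 3 → ℝ) (hd : Matrix.det (Matrix.diagonal fun i => (d i : ℂ)) ≠ 0) :
    formCongr (starRingEnd ℂ) (Matrix.GeneralLinearGroup.mkOfDetNeZero _ hd) (Matrix.diagonal fun i => (b i : ℂ)) =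
      Matrix.diagonal fun i => (((d i) ^ 2 * b i : ℝ) : ℂ) := by
  rw [formCongr, Matrix.GeneralLinearGroup.val_mkOfDetNeZero, Matrix.diagonal_map (map_zero _), Matrix.diagonal_transpose, Matrix.diagonal_mul_diagonal,
    Matrix.diagonal_mul_diagonal]
  congr 1
  funext i
  rw [Complex.conj_ofReal]
  push_cast
  ring

end Standard

/-! ## §2 `formCongr` algebra and the rescaling datum between two split-chart frames -/

section FormAlgebra

variable {n : Type*} [Fintype n] [DecidableEq n]

/-- `formCongr` is contravariantly multiplicative: `formCongr (S · T) H = formCongr T (formCongr S H)`. [cite: PlatonovRapinchuk1994, §2.3] -/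
theorem formCongr_mul (σ : ℂ →+* ℂ) (S T : GL n ℂ) (H : Matrix n n ℂ) : formCongr σ (S * T) H = formCongr σ T (formCongr σ S H) := by
  simp only [formCongr, Units.val_mul, Matrix.map_mul, Matrix.transpose_mul, Matrix.mul_assoc]

/-- `formCongr` is linear in the form: `formCongr T (c • H) = c • formCongr T H`. [cite: PlatonovRapinchuk1994, §2.3] -/
theorem formCongr_smul (σ : ℂ →+* ℂ) (T : GL n ℂ) (c : ℂ) (H : Matrix n n ℂ) : formCongr σ T (c • H) = c • formCongr σ T H := by
  simp only [formCongr, Matrix.mul_smul, Matrix.smul_mul]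

end FormAlgebra

section Scale

variable {a b : Fin 3 → ℝ} (ha : a 0 * a 2 < 0 ∧ 0 < a 0 * a 1) (hb : b 0 * b 2 < 0 ∧ 0 < b 0 * b 1)

include ha hb in
/-- The middle rescaling radicand `b₀a₁∕(a₀b₁)` is positive (slots `0, 1` carry the same sign in both frames). [cite: Rogawski1990, §3.6 p. 31] -/
theorem innerTwistScale_mid_pos : 0 < b 0 * a 1 / (a 0 * b 1) := by
  rw [div_pos_iff, ← mul_pos_iff]
  nlinarith [ha.2, hb.2, mul_pos ha.2 hb.2]

include ha in
/-- `a₀ ≠ 0`, `a₁ ≠ 0`, `a₂ ≠ 0` in a hyperbolic frame. [cite: Rogawski1990, §3.6 p. 31] -/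
theorem innerTwistScale_ne_zero : a 0 ≠ 0 ∧ a 1 ≠ 0 ∧ a 2 ≠ 0 := by
  refine ⟨fun h => ?_, fun h => ?_, fun h => ?_⟩
  · rw [h, zero_mul] at ha; exact lt_irrefl _ ha.1
  · rw [h, mul_zero] at ha; exact lt_irrefl _ ha.2
  · rw [h, mul_zero] at ha; exact lt_irrefl _ ha.1

include ha hb in
/-- **THE FORM IDENTITY**: with `d = (1, √(b₀a₁∕(a₀b₁)), r_a∕r_b)`, `d_i² · b_i = (b₀∕a₀) · a_i` for `i = 0, 1, 2`. [cite: PlatonovRapinchuk1994, §2.3] [cite: Rogawski1990, §3.6 p. 31] -/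
theorem innerTwistScale_sq_mul (i : Fin 3) :
    (![1, Real.sqrt (b 0 * a 1 / (a 0 * b 1)), Real.sqrt (-a 2 / a 0) / Real.sqrt (-b 2 / b 0)] i) ^ 2 * b i = b 0 / a 0 * a i := by
  obtain ⟨ha0, ha1, ha2⟩ := innerTwistScale_ne_zero ha
  obtain ⟨hb0, hb1, hb2⟩ := innerTwistScale_ne_zero hb
  have hra : 0 ≤ -a 2 / a 0 := neg_div_nonneg_of_mul_neg a ha.1
  have hrb : 0 ≤ -b 2 / b 0 := neg_div_nonneg_of_mul_neg b hb.1
  have hrb0 : Real.sqrt (-b 2 / b 0) ≠ 0 := sqrt_ratio_ne_zero hb.1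
  fin_cases i
  · show (1 : ℝ) ^ 2 * b 0 = b 0 / a 0 * a 0
    field_simp
  · show (Real.sqrt (b 0 * a 1 / (a 0 * b 1))) ^ 2 * b 1 = b 0 / a 0 * a 1
    rw [Real.sq_sqrt (innerTwistScale_mid_pos ha hb).le]
    field_simp
  · show (Real.sqrt (-a 2 / a 0) / Real.sqrt (-b 2 / b 0)) ^ 2 * b 2 = b 0 / a 0 * a 2
    rw [div_pow, Real.sq_sqrt hra, Real.sq_sqrt hrb]
    field_simp

include ha hb in
/-- The rescaling entries are non-zero. [cite: Rogawski1990, §3.6 p. 31] -/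
theorem innerTwistScale_entry_ne_zero (i : Fin 3) :
    (![1, Real.sqrt (b 0 * a 1 / (a 0 * b 1)), Real.sqrt (-a 2 / a 0) / Real.sqrt (-b 2 / b 0)] i) ≠ 0 := by
  fin_cases i
  · exact one_ne_zero
  · exact (Real.sqrt_pos.2 (innerTwistScale_mid_pos ha hb)).ne'
  · exact div_ne_zero (sqrt_ratio_ne_zero ha.1) (sqrt_ratio_ne_zero hb.1)

include ha hb in
/-- `det diag(d) ≠ 0` for the rescaling. [cite: Rogawski1990, §3.6 p. 31] -/
theorem det_innerTwistScale_ne_zero :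
    Matrix.det (Matrix.diagonal fun i => ((![1, Real.sqrt (b 0 * a 1 / (a 0 * b 1)), Real.sqrt (-a 2 / a 0) / Real.sqrt (-b 2 / b 0)] i : ℝ) : ℂ)) ≠ 0 := by
  rw [Matrix.det_diagonal]
  exact Finset.prod_ne_zero_iff.2 fun i _ => Complex.ofReal_ne_zero.2 (innerTwistScale_entry_ne_zero ha hb i)

end Scale

/-! ## §3 The place isomorphism `ι_w : U(α)_w ≃ₜ* U(β)_w` carrying chart to chart -/

section Place

variable (L : Type) [Field L] (α β : Fin 3 → L) (w : {w : InfinitePlace L // IsComplex w})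

/-- **(IT1) THE EXPLICIT PLACE ISOMORPHISM CARRYING THE CARTAN ATLAS CHART TO CHART.**  At a place `w` that is a split-chart place for both house frames `α` and `β` (`α_i, β_i ≠ 0`;
reality is part of ★ `splitChartPlaces`) there is a topological-group isomorphism `ι : U(α)_w ≃ₜ* U(β)_w` — conjugation by the fixed `M_w = M(τ_β) · D · M(τ_α)⁻¹ ∈ GL₃(ℂ)` of the
module docstring — with `ι (gprimeBlockAt α w S′ c) = gprimeBlockAt β w S′ c` for EVERY label `S′` (split chart at `w ∈ S′`, compact chart at `w ∉ S′`) and every `c`, and acting by an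
ambient conjugation (`∃ M, ∀ h, ι h = M h M⁻¹`; the token the smooth-model files read). [cite: PlatonovRapinchuk1994, §2.3] [cite: Rogawski1990, §14.2 p. 233; §3.6 p. 31]
[cite: Knapp1986, Ch. V §3] [cite: BrockerTomDieck1985, IV (3.2)] -/
theorem exists_continuousMulEquiv_archLocal_innerTwist (hα : ∀ i, α i ≠ 0) (hβ : ∀ i, β i ≠ 0) (hwα : w ∈ splitChartPlaces L α) (hwβ : w ∈ splitChartPlaces L β) :
    ∃ ι : ↥(archLocal L 3 (Matrix.diagonal α) w) ≃ₜ* ↥(archLocal L 3 (Matrix.diagonal β) w),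
      (∀ (S' : Finset {w : InfinitePlace L // IsComplex w}) (cw : Fin 3 → ℝ), ι (gprimeBlockAt L α w S' cw) = gprimeBlockAt L β w S' cw) ∧
      ∃ M : GL (Fin 3) ℂ, ∀ h : ↥(archLocal L 3 (Matrix.diagonal α) w),
        ((ι h : ↥(archLocal L 3 (Matrix.diagonal β) w)) : GL (Fin 3) ℂ) = M * (h : GL (Fin 3) ℂ) * M⁻¹ := by
  -- slot orders, slot-order weights, signs
  set τa : Perm (Fin 3) := lineOf (formSign L α w) with hτa
  set τb : Perm (Fin 3) := lineOf (formSign L β w) with hτb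
  set a : Fin 3 → ℝ := formRe L α w ∘ τa with ha_def
  set b : Fin 3 → ℝ := formRe L β w ∘ τb with hb_def
  have ha : a 0 * a 2 < 0 ∧ 0 < a 0 * a 1 := formRe_lineOf_signs L α w hα hwα
  have hb : b 0 * b 2 < 0 ∧ 0 < b 0 * b 1 := formRe_lineOf_signs L β w hβ hwβ
  obtain ⟨ha0, ha1, ha2⟩ := innerTwistScale_ne_zero ha
  obtain ⟨hb0, hb1, hb2⟩ := innerTwistScale_ne_zero hb
  -- the rescaling `D`, the permutation matrices, the congruence `M`
  set d : Fin 3 → ℝ := ![1, Real.sqrt (b 0 * a 1 / (a 0 * b 1)), Real.sqrt (-a 2 / a 0) / Real.sqrt (-b 2 / b 0)] with hd_def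
  have hdet : Matrix.det (Matrix.diagonal fun i => ((d i : ℝ) : ℂ)) ≠ 0 := det_innerTwistScale_ne_zero ha hb
  set D : GL (Fin 3) ℂ := Matrix.GeneralLinearGroup.mkOfDetNeZero _ hdet with hD
  set Pa : GL (Fin 3) ℂ := Matrix.GeneralLinearGroup.mkOfDetNeZero _ (det_monomial_one_ne_zero 3 τa) with hPa
  set Pb : GL (Fin 3) ℂ := Matrix.GeneralLinearGroup.mkOfDetNeZero _ (det_monomial_one_ne_zero 3 τb) with hPb
  set M : GL (Fin 3) ℂ := Pb * D * Pa⁻¹ with hM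
  -- the two place forms are the real diagonals `diag(formRe)`
  have hHα : (Matrix.diagonal α).map w.1.embedding = Matrix.diagonal fun i => ((formRe L α w i : ℝ) : ℂ) := diagonal_map_embedding_eq_of_real hwα.1
  have hHβ : (Matrix.diagonal β).map w.1.embedding = Matrix.diagonal fun i => ((formRe L β w i : ℝ) : ℂ) := diagonal_map_embedding_eq_of_real hwβ.1
  -- THE FORM IDENTITY `formCongr M (σ_w diag β) = (b₀∕a₀) • σ_w diag α`
  have hc0 : ((b 0 / a 0 : ℝ) : ℂ) ≠ 0 := Complex.ofReal_ne_zero.2 (div_ne_zero hb0 ha0)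
  have hform : formCongr (starRingEnd ℂ) M ((Matrix.diagonal β).map w.1.embedding) = ((b 0 / a 0 : ℝ) : ℂ) • (Matrix.diagonal α).map w.1.embedding := by
    rw [hM, formCongr_mul, formCongr_mul, hPb, formCongr_monomialGL_map_diagonal L 3 β w τb,
      diagonal_map_embedding_eq_of_real (α := β ∘ τb) (fun i => hwβ.1 _)]
    have hDform : formCongr (starRingEnd ℂ) D (Matrix.diagonal fun i => ((formRe L (β ∘ τb) w i : ℝ) : ℂ)) =
        ((b 0 / a 0 : ℝ) : ℂ) • Matrix.diagonal fun i => ((formRe L (α ∘ τa) w i : ℝ) : ℂ) := by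
      have e1 : (fun i => ((formRe L (β ∘ τb) w i : ℝ) : ℂ)) = fun i => ((b i : ℝ) : ℂ) := rfl
      rw [e1, hD, formCongr_diagonal_real_diagonal b d hdet, ← Matrix.diagonal_smul]
      congr 1
      funext i
      have hsq := innerTwistScale_sq_mul ha hb i
      rw [← hd_def] at hsq
      rw [Pi.smul_apply, smul_eq_mul, hsq]
      push_cast
      rfl
    rw [hDform, formCongr_smul, ← diagonal_map_embedding_eq_of_real (α := α ∘ τa) (fun i => hwα.1 _), ← formCongr_monomialGL_map_diagonal L 3 α w τa, hPa,
      formCongr_inv_formCongr]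
  -- membership: `g ∈ U(α)_w ↔ M g M⁻¹ ∈ U(β)_w`
  have hmem : ∀ g : GL (Fin 3) ℂ, g ∈ archLocal L 3 (Matrix.diagonal α) w ↔ GLn.conjEquiv M g ∈ archLocal L 3 (Matrix.diagonal β) w := fun g => by
    rw [GLn.conjEquiv_apply]
    show g ∈ unitaryGroupOfForm (starRingEnd ℂ) ((Matrix.diagonal α).map w.1.embedding) ↔
      M * g * M⁻¹ ∈ unitaryGroupOfForm (starRingEnd ℂ) ((Matrix.diagonal β).map w.1.embedding)
    rw [conj_mem_unitaryGroupOfForm_iff, hform, unitaryGroupOfForm_smul_eq _ hc0]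
  refine ⟨ContinuousMulEquiv.restrictSubgroup (GLn.conjEquiv M) _ _ hmem, fun S' cw => ?_, ⟨M, fun h => rfl⟩⟩
  -- THE CHART CLAUSE
  apply Subtype.ext
  rw [ContinuousMulEquiv.coe_restrictSubgroup_apply, GLn.conjEquiv_apply]
  have hMinv : M⁻¹ = Pa * D⁻¹ * Pb⁻¹ := by rw [hM]; simp only [_root_.mul_inv_rev, inv_inv, mul_assoc]
  by_cases hw : w ∈ S'
  · -- split chart: `M · (Pa · B(a) · Pa⁻¹) · M⁻¹ = Pb · (D B(a) D⁻¹) · Pb⁻¹ = Pb · B(b) · Pb⁻¹`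
    have hα' : ((gprimeBlockAt L α w S' cw : ↥(archLocal L 3 (Matrix.diagonal α) w)) : GL (Fin 3) ℂ) =
        Pa * Matrix.GeneralLinearGroup.mkOfDetNeZero (boostStd a cw) (det_boostStd_ne_zero _ _) * Pa⁻¹ := by
      rw [gprimeBlockAt, coe_gprimeBlock_of_mem L α (fun _ => cw) hw hwα, hPa]
      exact (conj_monomialGL_boostStd_eq_gprimeSplitGL τa (formRe L α w) cw).symm
    have hβ' : ((gprimeBlockAt L β w S' cw : ↥(archLocal L 3 (Matrix.diagonal β) w)) : GL (Fin 3) ℂ) =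
        Pb * Matrix.GeneralLinearGroup.mkOfDetNeZero (boostStd b cw) (det_boostStd_ne_zero _ _) * Pb⁻¹ := by
      rw [gprimeBlockAt, coe_gprimeBlock_of_mem L β (fun _ => cw) hw hwβ, hPb]
      exact (conj_monomialGL_boostStd_eq_gprimeSplitGL τb (formRe L β w) cw).symm
    have hDB : D * Matrix.GeneralLinearGroup.mkOfDetNeZero (boostStd a cw) (det_boostStd_ne_zero _ _) =
        Matrix.GeneralLinearGroup.mkOfDetNeZero (boostStd b cw) (det_boostStd_ne_zero _ _) * D := by
      apply Units.ext
      simp only [Units.val_mul, hD, Matrix.GeneralLinearGroup.val_mkOfDetNeZero]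
      have hra0 : Real.sqrt (-a 2 / a 0) ≠ 0 := sqrt_ratio_ne_zero ha.1
      have hrb0 : Real.sqrt (-b 2 / b 0) ≠ 0 := sqrt_ratio_ne_zero hb.1
      refine diagonal_mul_boostStd_eq_boostStd_mul_diagonal a b d ?_ ?_ cw
      · show (1 : ℝ) * Real.sqrt (-a 2 / a 0) = Real.sqrt (-b 2 / b 0) * (Real.sqrt (-a 2 / a 0) / Real.sqrt (-b 2 / b 0))
        rw [one_mul, mul_div_assoc', mul_comm (Real.sqrt (-b 2 / b 0)), mul_div_assoc, div_self hrb0, mul_one]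
      · show Real.sqrt (-a 2 / a 0) / Real.sqrt (-b 2 / b 0) * (Real.sqrt (-a 2 / a 0))⁻¹ = (Real.sqrt (-b 2 / b 0))⁻¹ * 1
        rw [mul_one, div_eq_mul_inv, mul_assoc, mul_comm ((Real.sqrt (-b 2 / b 0))⁻¹), ← mul_assoc, mul_inv_cancel₀ hra0, one_mul]
    rw [hα', hβ', hMinv, hM]
    calc Pb * D * Pa⁻¹ * (Pa * Matrix.GeneralLinearGroup.mkOfDetNeZero (boostStd a cw) (det_boostStd_ne_zero _ _) * Pa⁻¹) * (Pa * D⁻¹ * Pb⁻¹)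
        = Pb * (D * Matrix.GeneralLinearGroup.mkOfDetNeZero (boostStd a cw) (det_boostStd_ne_zero _ _)) * D⁻¹ * Pb⁻¹ := by group
      _ = Pb * Matrix.GeneralLinearGroup.mkOfDetNeZero (boostStd b cw) (det_boostStd_ne_zero _ _) * Pb⁻¹ := by rw [hDB]; group
  · -- compact chart: both are relabelled unit diagonals, and `D` commutes with diagonals
    have hα' : ((gprimeBlockAt L α w S' cw : ↥(archLocal L 3 (Matrix.diagonal α) w)) : GL (Fin 3) ℂ) =
        Pa * circleDiagonal 3 (fun k => Circle.exp (cw k)) * Pa⁻¹ := by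
      rw [gprimeBlockAt, coe_gprimeBlock_of_not_mem L α (fun _ => cw) hw, hPa, monomial_conj_circleDiagonal]
      rfl
    have hβ' : ((gprimeBlockAt L β w S' cw : ↥(archLocal L 3 (Matrix.diagonal β) w)) : GL (Fin 3) ℂ) =
        Pb * circleDiagonal 3 (fun k => Circle.exp (cw k)) * Pb⁻¹ := by
      rw [gprimeBlockAt, coe_gprimeBlock_of_not_mem L β (fun _ => cw) hw, hPb, monomial_conj_circleDiagonal]
      rfl
    have hDz : D * circleDiagonal 3 (fun k => Circle.exp (cw k)) = circleDiagonal 3 (fun k => Circle.exp (cw k)) * D := by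
      apply Units.ext
      simp only [Units.val_mul, hD, Matrix.GeneralLinearGroup.val_mkOfDetNeZero, coe_circleDiagonal, Matrix.diagonal_mul_diagonal]
      congr 1
      funext i
      ring
    rw [hα', hβ', hMinv, hM]
    calc Pb * D * Pa⁻¹ * (Pa * circleDiagonal 3 (fun k => Circle.exp (cw k)) * Pa⁻¹) * (Pa * D⁻¹ * Pb⁻¹)
        = Pb * (D * circleDiagonal 3 (fun k => Circle.exp (cw k))) * D⁻¹ * Pb⁻¹ := by group
      _ = Pb * circleDiagonal 3 (fun k => Circle.exp (cw k)) * Pb⁻¹ := by rw [hDz]; group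

end Place

/-! ## §4 (IT2) The place isomorphism carries the local chart torus onto the local chart torus -/

section Torus

variable (L : Type) [Field L] [NumberField L] [IsCMField L] (α β : Fin 3 → L) (w : {w : InfinitePlace L // IsComplex w})
  (ι : ↥(archLocal L 3 (Matrix.diagonal α) w) ≃ₜ* ↥(archLocal L 3 (Matrix.diagonal β) w))
  (hι : ∀ (S' : Finset {w : InfinitePlace L // IsComplex w}) (cw : Fin 3 → ℝ), ι (gprimeBlockAt L α w S' cw) = gprimeBlockAt L β w S' cw)
  (S' : Finset {w : InfinitePlace L // IsComplex w})

include hι in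
/-- The chart ranges correspond under `ι`: `ι '' range(gprimeBlockAt α w S′) = range(gprimeBlockAt β w S′)` as subgroups (★ `gprimeBlockAtHom`). [cite: Rogawski1990, §3.6 p. 31] -/
theorem map_innerTwist_range_gprimeBlockAtHom :
    (gprimeBlockAtHom L α w S').range.map ι.toMonoidHom = (gprimeBlockAtHom L β w S').range := by
  ext g
  constructor
  · rintro ⟨h, ⟨x, rfl⟩, rfl⟩
    refine ⟨x, ?_⟩
    rw [gprimeBlockAtHom_apply, gprimeBlockAtHom_apply]
    exact (hι S' _).symm
  · rintro ⟨x, rfl⟩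
    refine ⟨gprimeBlockAtHom L α w S' x, ⟨x, rfl⟩, ?_⟩
    rw [gprimeBlockAtHom_apply, gprimeBlockAtHom_apply]
    exact hι S' _

include hι in
/-- **(IT2) THE PLACE ISOMORPHISM CARRIES `T′_{S′,w}` ONTO `T′_{S′,w}`** (closures of the chart ranges under a homeomorphic group isomorphism): `ι g ∈ chartTorusGLoc β w S′ ↔ g ∈ chartTorusGLoc α w S′`
— the `hHH′` binder of ★ `cosetCongr`, for EVERY label `S′`. [cite: Rogawski1990, §3.6 p. 31; §14.2 p. 233] -/
theorem innerTwist_mem_chartTorusGLoc_iff (g : ↥(archLocal L 3 (Matrix.diagonal α) w)) :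
    ι g ∈ chartTorusGLoc L β w S' ↔ g ∈ chartTorusGLoc L α w S' := by
  have hcl : (chartTorusGLoc L β w S' : Set ↥(archLocal L 3 (Matrix.diagonal β) w)) = ι '' (chartTorusGLoc L α w S' : Set ↥(archLocal L 3 (Matrix.diagonal α) w)) := by
    rw [chartTorusGLoc, chartTorusGLoc, Subgroup.topologicalClosure_coe, Subgroup.topologicalClosure_coe]
    have himg : ι '' ((gprimeBlockAtHom L α w S').range : Set ↥(archLocal L 3 (Matrix.diagonal α) w)) =
        ((gprimeBlockAtHom L β w S').range : Set ↥(archLocal L 3 (Matrix.diagonal β) w)) := by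
      rw [← map_innerTwist_range_gprimeBlockAtHom L α β w ι hι S', Subgroup.coe_map]
      rfl
    rw [← himg]
    exact (ι.toHomeomorph.image_closure _).symm
  rw [← SetLike.mem_coe, hcl, Set.mem_image]
  constructor
  · rintro ⟨h, hh, hhg⟩
    rwa [← ι.injective hhg]
  · exact fun hg => ⟨g, hg, rfl⟩

include hι in
/-- `ι` restricted to the chart tori, as an image statement. [cite: Rogawski1990, §3.6 p. 31] -/
theorem innerTwist_image_chartTorusGLoc :
    ι '' (chartTorusGLoc L α w S' : Set ↥(archLocal L 3 (Matrix.diagonal α) w)) = (chartTorusGLoc L β w S' : Set ↥(archLocal L 3 (Matrix.diagonal β) w)) := by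
  ext h
  rw [Set.mem_image, SetLike.mem_coe]
  constructor
  · rintro ⟨g, hg, rfl⟩
    exact (innerTwist_mem_chartTorusGLoc_iff L α β w ι hι S' g).2 hg
  · intro hh
    exact ⟨ι.symm h, (innerTwist_mem_chartTorusGLoc_iff L α β w ι hι S' (ι.symm h)).1 (by rw [ContinuousMulEquiv.apply_symm_apply]; exact hh),
      ContinuousMulEquiv.apply_symm_apply ι h⟩

end Torus

end Literature.NumberTheory.Automorphic.UnitaryGroup

end
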